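import Summits.BirchSwinnertonDyer.Rank1Residual.Additive.GordRankOneKatoCertificate
import Summits.BirchSwinnertonDyer.Rank1Residual.Additive.GordCycRankOneLambda
import HarnessLib

/-!
# The (G)-cell at analytic rank ONE, defect 2 — CLASS LEVEL: on X4♯(G-ord) ∩ I₀* ∩ {ρ̄ onto} (Kato)
# and X3♯(G-ord) ∩ I₀* (Wuthrich) the one-number certificate DISCHARGES `λ ≤ 1` AND `μ = 0` for every
# generator of `char_Λ X(E/ℚ_∞)`; the constant-term half of the certificate is a THEOREM when
# `L(E,1) = 0` (cell `b2b-bsdres`, sub-cell additive-p2, gen 19; sequel of `GordRankOneKatoCertificate`)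

HONEST FRAMING (cell `b2b-bsdres`, run/shared/lean/b2b/bsd-rank1-residual/, verbatim in every
file): the goal of the cell is to DELETE the COMBINATION-SHAPED residual classes of the
Birch–Swinnerton-Dyer formula for ALL analytic-rank `≤ 1` elliptic curves over `ℚ` — "full BSD
formula for every rank `≤ 1` curve in class `C`" assembled STRICTLY from published theorems — so
that the rank-`≤ 1` remainder becomes exactly the CONSTRUCTION-SHAPED classes, which are TYPED
(missing-input `Prop`s), NOT attempted. This is not "finishing BSD". Sub-cell `additive-p2`
(CLASS-OWNERS row "X3/X4 additive — pot. good ordinary / X3♯(G-ord)"), generation 19: research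
route; no claim beyond the stated classes; X3♯(G-ord)/X4♯(G-ord) stay CONSTRUCTION-SHAPED; labels /
census / located gap UNCHANGED; nothing is booked. Theorems only (no definition, no new named fact;
named facts enter as HYPOTHESES: the semistable half-eigenspace readings of Kato 2004 Thm. 17.4 (3) /
Wuthrich 2014 Thm. 16, Delbourgo 2002 (A)+(B) = A175, Pal 2012 Thm. 3.2, GZK, modularity).

What (see the module docstring of `GordRankOneKatoCertificate.lean` for the chain and the reading):
* `ClassX4Gord.isTorsion_and_mu_zero_lam_le_one_of_katoHalf_of_cert` /
  `ClassX3Gord.isTorsion_and_mu_zero_lam_le_one_of_wuthrichHalf_of_cert`: class hypotheses + defect `2`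
  (+ `Surj W p`, `p ≥ 5` on X4; odd `p` on X3) + `BranchUnitCertificateAt W p` ⟹ for every cyclotomic
  dual datum and generator `fE`: `X` torsion, `μ(fE) = 0`, `λ(fE) ≤ 1`; hence n1011-p01's
  `CharLamLeAt W p 1` (`…charLamLeAt_one_…`).
* `constantCoeff_branch_eq_zero_of_entireLFunction_one_eq_zero`: `L(E,1) = 0 ⟹` the Néron-normalised
  branch `ϖ·B_{(p−1)/2}` has constant term `0` (interpolation + Birch/Pal), so the certificate is ONE
  number (`branchUnitCertificateAt_of_norm_coeff_one`).
Nothing booked; labels UNCHANGED.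

References: K. Kato, Astérisque 295 (2004) Thm. 17.4 (3) [Kato2004Asterisque]; C. Wuthrich, Doc.
Math. 19 (2014) Thm. 16 [Wuthrich2014]; A. Pal, Canad. Math. Bull. 55 (2012) Thm. 3.2 [Pal2012];
B. Mazur, J. Tate, J. Teitelbaum, Invent. Math. 84 (1986) §I.13–I.14 [MazurTateTeitelbaum1986Invent];
L. Washington, GTM 83 (1997) §7.1 [Washington1997].
-/

noncomputable section

open scoped Classical MatrixGroups ModularForm NumberField

namespace Summit.BirchSwinnertonDyer.Rank1Residual.Additive

open CongruenceSubgroup WeierstrassCurve NumberField Literature.NumberTheory.EllipticCurves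
  Literature.NumberTheory.EllipticCurves.ModularForms
  Literature.NumberTheory.EllipticCurves.Rank1Residual
  Literature.NumberTheory.EllipticCurves.Rank1Residual.Typed
  Literature.NumberTheory.GaloisRepresentations Summit.BirchSwinnertonDyer.Rank1Residual.AdditivePotMult
  Summit.BirchSwinnertonDyer.Rank1Residual.X1.MuLambda
  Summit.BirchSwinnertonDyer.Rank1Residual.X1.RankOneParitySqueeze
  IsDedekindDomain

variable (W : WeierstrassCurve ℚ) [W.IsElliptic] (p : ℕ) [hp : Fact p.Prime]

/-! ### §3 Class level, defect 2: the certificate DISCHARGES `λ ≤ 1` and `μ = 0` -/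

variable [W.IsGloballyMinimal]

omit [W.IsGloballyMinimal] hp in
variable {W p} in
/-- The period ratio of the parity of `(p−1)/2` exists for any parametrisation datum of `V`
(`Ω⁺_f = ϖ·Ω_V`, resp. `Ω⁻_f = ϖ⁻·|Ω⁻(V)|`). [folklore] -/
theorem exists_periodRatio_parity (V : WeierstrassCurve ℚ) [V.IsElliptic] [V.IsGloballyMinimal]
    {N : ℕ} [NeZero N] (Dm : ModularParametrizationData V N) :
    ∃ ϖ : ℚ, if Even (p / 2) then (ϖ : ℝ) * V.realPeriodRat = plusPeriod Dm.f
      else (ϖ : ℝ) * V.imaginaryPeriodRat = minusPeriod Dm.f := by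
  by_cases h : Even (p / 2)
  · obtain ⟨ϖ, -, hϖ, -⟩ := Dm.exists_rat_mul_realPeriodRat_eq_plusPeriod
    exact ⟨ϖ, by rw [if_pos h]; exact hϖ⟩
  · obtain ⟨ϖ, -, hϖ⟩ := exists_rat_mul_imaginaryPeriodRat_eq_minusPeriod Dm
    exact ⟨ϖ, by rw [if_neg h]; exact hϖ⟩

variable {W p}

/-- **The constant-term half of the certificate is a THEOREM when `L(E,1) = 0`.** For `E = W`
additive at the odd prime `p` with `L(E,1) = 0` (e.g. `ord_{s=1} L(E,s) = 1`), `V = E♭` globally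
minimal and ordinary at `p` with `C • V^{(p*)} = W`, `f` the newform of `V` and `ϖ` the period ratio of
the parity of `(p−1)/2`: the Néron-normalised branch `ϖ·B_{(p−1)/2}(f, α)` has constant term `0` —
by INTERPOLATION (`B_{(p−1)/2}(0) = α⁻¹·∑_a (a/p)[a/p]^±_f`, additive-p4) and Birch's formula
`L(E,1) = ±ϖ·(∑…)·Ω_E[/(|u(C)|·c_∞)]` (PROVED at `p ≡ 3 (mod 4)`; Pal 2012 Thm. 3.2 = `hPal` at
`p ≡ 1 (mod 4)`). So only the LINEAR coefficient is a genuine per-pair computation.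
[cite: MazurTateTeitelbaum1986Invent, §I.13–I.14] [cite: Pal2012, Thm. 3.2] -/
theorem constantCoeff_branch_eq_zero_of_entireLFunction_one_eq_zero
    (hPal : Pal2012.thm32_sqrt_mul_realPeriodRat_twist_eq_of_prime_one_mod_four)
    (hmod : hasEntireLFunction_rat) (hp2 : p ≠ 2) (hadd : Addv W p) (hL : W.entireLFunction 1 = 0)
    (V : WeierstrassCurve ℚ) [V.IsElliptic] [V.IsGloballyMinimal] (C : VariableChange ℚ)
    (hC : C • V.quadraticTwist ((-1 : ℚ) ^ (p / 2) * p) = W) (hord : IsOrdinaryAt V p)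
    {N : ℕ} [NeZero N] {f : CuspForm (Gamma0 N) 2} (hf : IsNewformOf V f)
    (ϖ : ℚ) (hϖ : if Even (p / 2) then (ϖ : ℝ) * V.realPeriodRat = plusPeriod f
      else (ϖ : ℝ) * V.imaginaryPeriodRat = minusPeriod f) :
    PowerSeries.constantCoeff (PowerSeries.C (ϖ : ℚ_[p]) *
        (if Even (p / 2) then padicLFunctionBranch f ((unitRoot V p : ℤ_[p]) : ℚ_[p]) (p / 2)
          else padicLFunctionMinusBranch f ((unitRoot V p : ℤ_[p]) : ℚ_[p]) (p / 2))) = 0 := by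
  have hΩ : (W.realPeriodRat : ℂ) ≠ 0 := by exact_mod_cast W.realPeriodRat_pos_holds.ne'
  have hodd : p % 4 = 1 ∨ p % 4 = 3 := by
    obtain ⟨k, hk⟩ := hp.out.odd_of_ne_two hp2
    omega
  rcases hodd with h1 | h3
  · have heven : Even (p / 2) := ⟨p / 4, by omega⟩
    have hC' : C • V.quadraticTwist (p : ℚ) = W := by
      rw [pStar_eq_of_mod_four p (Or.inl h1), if_pos h1] at hC
      exact hC
    rw [if_pos heven] at hϖ
    rw [if_pos heven, map_mul, PowerSeries.constantCoeff_C,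
      constantCoeff_padicLFunctionBranch_half p hp2 V hord hf]
    obtain ⟨ε, hε, hLq⟩ :=
      entireLFunction_one_eq_of_twist p hPal hmod h1 V W ⟨C, hC'⟩ (Or.inl hord.1) hadd hf ϖ hϖ
    rw [hL] at hLq
    have hzero : ε * (ϖ * legendrePlusSymbolSum f p) = 0 := by
      exact_mod_cast (mul_eq_zero.mp hLq.symm).resolve_right hΩ
    have hε0 : ε ≠ 0 := by rcases hε with rfl | rfl <;> norm_num
    have hϖS : ϖ * legendrePlusSymbolSum f p = 0 := (mul_eq_zero.mp hzero).resolve_left hε0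
    have hϖS' : (ϖ : ℚ_[p]) * (legendrePlusSymbolSum f p : ℚ_[p]) = 0 := by exact_mod_cast hϖS
    calc (ϖ : ℚ_[p]) * ((((unitRoot V p : ℤ_[p]) : ℚ_[p]))⁻¹ * (legendrePlusSymbolSum f p : ℚ_[p]))
        = (((unitRoot V p : ℤ_[p]) : ℚ_[p]))⁻¹ *
            ((ϖ : ℚ_[p]) * (legendrePlusSymbolSum f p : ℚ_[p])) := by ring
      _ = 0 := by rw [hϖS', mul_zero]
  · have hnot : ¬ Even (p / 2) := by rw [Nat.not_even_iff_odd]; exact ⟨p / 4, by omega⟩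
    have hC' : C • V.quadraticTwist (-(p : ℚ)) = W := by
      rw [pStar_eq_of_mod_four p (Or.inr h3), if_neg (by omega)] at hC
      exact hC
    rw [if_neg hnot] at hϖ
    rw [if_neg hnot, map_mul, PowerSeries.constantCoeff_C,
      constantCoeff_padicLFunctionMinusBranch_half p hp2 V hord hf]
    obtain ⟨ε, hε, hLq⟩ := entireLFunction_one_eq_of_twist_neg p hmod h3 V W C hC' hadd hf ϖ hϖ
    rw [hL] at hLq
    have hzero : ε * (ϖ * legendreMinusSymbolSum f p) /
        (|(C.u : ℚ)| * ((W.baseChange ℝ).numRealComponents : ℚ)) = 0 := by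
      exact_mod_cast (mul_eq_zero.mp hLq.symm).resolve_right hΩ
    have hε0 : ε ≠ 0 := by rcases hε with rfl | rfl <;> norm_num
    have hua0 : |(C.u : ℚ)| ≠ 0 := abs_ne_zero.mpr C.u.ne_zero
    have hcinf0 : ((W.baseChange ℝ).numRealComponents : ℚ) ≠ 0 := by
      rw [numRealComponents]
      split_ifs <;> norm_num
    have hϖS : ϖ * legendreMinusSymbolSum f p = 0 := by
      rcases div_eq_zero_iff.mp hzero with h | h
      · exact (mul_eq_zero.mp h).resolve_left hε0
      · exact absurd h (mul_ne_zero hua0 hcinf0)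
    have hϖS' : (ϖ : ℚ_[p]) * (legendreMinusSymbolSum f p : ℚ_[p]) = 0 := by exact_mod_cast hϖS
    calc (ϖ : ℚ_[p]) * ((((unitRoot V p : ℤ_[p]) : ℚ_[p]))⁻¹ * (legendreMinusSymbolSum f p : ℚ_[p]))
        = (((unitRoot V p : ℤ_[p]) : ℚ_[p]))⁻¹ *
            ((ϖ : ℚ_[p]) * (legendreMinusSymbolSum f p : ℚ_[p])) := by ring
      _ = 0 := by rw [hϖS', mul_zero]

/-- **The certificate from ONE number when `L(E,1) = 0`**: if every Néron-normalised branch of the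
twist has linear coefficient of `p`-adic norm `1` (`hone`; the per-pair computation), then
`BranchUnitCertificateAt W p` (its constant-term half being
`constantCoeff_branch_eq_zero_of_entireLFunction_one_eq_zero`). [cite: Pal2012, Thm. 3.2]
[cite: MazurTateTeitelbaum1986Invent, §I.13–I.14] -/
theorem branchUnitCertificateAt_of_norm_coeff_one
    (hPal : Pal2012.thm32_sqrt_mul_realPeriodRat_twist_eq_of_prime_one_mod_four)
    (hmod : hasEntireLFunction_rat) (hp2 : p ≠ 2) (hadd : Addv W p) (hL : W.entireLFunction 1 = 0)
    (hone : ∀ (V : WeierstrassCurve ℚ) [V.IsElliptic] [V.IsGloballyMinimal] (C : VariableChange ℚ),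
      C • V.quadraticTwist ((-1 : ℚ) ^ (p / 2) * p) = W → IsOrdinaryAt V p →
      ∀ {N : ℕ} [NeZero N] (f : CuspForm (Gamma0 N) 2), IsNewformOf V f →
      ∀ ϖ : ℚ, (if Even (p / 2) then (ϖ : ℝ) * V.realPeriodRat = plusPeriod f
          else (ϖ : ℝ) * V.imaginaryPeriodRat = minusPeriod f) →
        ‖PowerSeries.coeff 1 (PowerSeries.C (ϖ : ℚ_[p]) *
            (if Even (p / 2) then padicLFunctionBranch f ((unitRoot V p : ℤ_[p]) : ℚ_[p]) (p / 2)
              else padicLFunctionMinusBranch f ((unitRoot V p : ℤ_[p]) : ℚ_[p]) (p / 2)))‖ = 1) :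
    BranchUnitCertificateAt W p :=
  fun V _ _ C hC hord _ _ f hf ϖ hϖ ↦
    ⟨constantCoeff_branch_eq_zero_of_entireLFunction_one_eq_zero hPal hmod hp2 hadd hL V C hC hord hf
      ϖ hϖ, hone V C hC hord f hf ϖ hϖ⟩

/-- **X4♯(G-ord) ∩ `I₀*` ∩ {`ρ̄_{E,p}` onto}, `p ≥ 5`: Kato's divisibility + the one-number certificate
⟹ for EVERY cyclotomic dual datum and EVERY generator `fE` of `char_Λ X(E/ℚ_∞)`: `X` is torsion,
`μ(fE) = 0` and `λ(fE) ≤ 1`.** Inputs: the semistable big-image component reading `hK`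
(Kato 2004 Thm. 17.4 (3), via `…_of_surjective_of_half`), modular parametrisation data (`hmodD`),
the good-ordinary twist model `E♭` (`ClassX4Gord.exists_goodOrd_pStar_twist_model`), Serre's lifting
of mod-`p` to `p`-adic surjectivity (`p ≥ 5`), §1–§2. NO Delbourgo, NO height, NO GZK here.
[cite: Kato2004Asterisque, Thm. 17.4 (3) (p. 273)] [cite: Washington1997, §7.1] -/
theorem ClassX4Gord.isTorsion_and_mu_zero_lam_le_one_of_katoHalf_of_cert
    (hK : Wuthrich2014.kato_halfEigenCharIdeal_dvd_cyclotomicPrime_of_surjective)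
    (hmodD : nonempty_modularParametrizationData)
    (hX : ClassX4Gord W p) (hp5 : 5 ≤ p) (he : semistabilityIndex W p = 2) (hsurj : Surj W p)
    (hcert : BranchUnitCertificateAt W p)
    {κ : ZpExtension ℚ p} {γ : Field.absoluteGaloisGroup ℚ}
    (hκ : κ.IsCyclotomic) (hγ : κ.IsTopGenerator γ) (hγ' : IsCyclotomicVariable p γ)
    (D : W.SelmerDualData κ γ) {fE : IwasawaAlgebra p} (hchar : D.charIdeal = Ideal.span {fE}) :
    D.IsTorsion ∧ mu fE = 0 ∧ lam fE ≤ 1 := by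
  have hp2 : p ≠ 2 := by omega
  obtain ⟨V, iV, iVm, C, hV, hC⟩ := hX.exists_goodOrd_pStar_twist_model W p he
  haveI : NeZero (V.conductorNorm ℤ) := ⟨(V.conductorNorm_pos_holds).ne'⟩
  obtain ⟨Dm⟩ := hmodD V
  obtain ⟨ϖ, hϖ⟩ := exists_periodRatio_parity (p := p) V Dm
  have hj := padicValRat_j_nonneg_of_typeGOrd W p hX.typeGOrd
  have hsurjV : ∀ n : ℕ, V.HasSurjectiveModNGaloisRep (p ^ n : ℕ) :=
    X4RankZeroTwistOdd.forall_surj_pow_twist_of_surj W p hp5 V (pStar_ne_zero p) C hC hsurj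
  have hord : IsOrdinaryAt V p :=
    isOrdinaryAt_of_goodOrd_or_mult_of_model_twist W V (pStar_ne_zero p) ⟨C, hC⟩ hj (Or.inl hV)
  obtain ⟨hXt, g, hg, u, hι⟩ := isTorsion_and_exists_iota_eq_branch_of_katoComponent W p
    (Kato2004.charIdeal_dvd_padicLFunctionBranch_component_of_surjective_of_half hK) hj hp2 V
    ⟨C, hC⟩ (Or.inl hV) hsurjV hκ hγ hγ' Dm.isNewformOf D ϖ hϖ
  obtain ⟨h0, h1⟩ := hcert V C hC hord Dm.f Dm.isNewformOf ϖ hϖ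
  exact ⟨hXt, mu_eq_zero_and_lam_le_one_of_iota_eq D hchar hg hι h0 h1⟩

/-- **X3♯(G-ord) ∩ `I₀*`, odd `p`: Wuthrich's divisibility + the one-number certificate ⟹ for EVERY
cyclotomic dual datum and generator: `X` torsion, `μ(fE) = 0`, `λ(fE) ≤ 1`** (`E[p]` reducible; the
semistable reducible component reading `hWu` = Wuthrich 2014 Thm. 16, via `…_of_half`).
[cite: Wuthrich2014, Thm. 16 (p. 397)] [cite: Washington1997, §7.1] -/
theorem ClassX3Gord.isTorsion_and_mu_zero_lam_le_one_of_wuthrichHalf_of_cert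
    (hWu : Wuthrich2014.thm16_halfEigenCharIdeal_dvd_cyclotomicPrime)
    (hmodD : nonempty_modularParametrizationData)
    (hp2 : p ≠ 2) (hX : ClassX3Gord W p) (he : semistabilityIndex W p = 2)
    (hcert : BranchUnitCertificateAt W p)
    {κ : ZpExtension ℚ p} {γ : Field.absoluteGaloisGroup ℚ}
    (hκ : κ.IsCyclotomic) (hγ : κ.IsTopGenerator γ) (hγ' : IsCyclotomicVariable p γ)
    (D : W.SelmerDualData κ γ) {fE : IwasawaAlgebra p} (hchar : D.charIdeal = Ideal.span {fE}) :
    D.IsTorsion ∧ mu fE = 0 ∧ lam fE ≤ 1 := by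
  obtain ⟨V, iV, iVm, C, hV, hC⟩ := hX.exists_goodOrd_pStar_twist_model W p hp2 he
  haveI : NeZero (V.conductorNorm ℤ) := ⟨(V.conductorNorm_pos_holds).ne'⟩
  obtain ⟨Dm⟩ := hmodD V
  obtain ⟨ϖ, hϖ⟩ := exists_periodRatio_parity (p := p) V Dm
  have hj := padicValRat_j_nonneg_of_typeGOrd W p hX.typeGOrd
  have hord : IsOrdinaryAt V p :=
    isOrdinaryAt_of_goodOrd_or_mult_of_model_twist W V (pStar_ne_zero p) ⟨C, hC⟩ hj (Or.inl hV)
  obtain ⟨hXt, g, hg, u, hι⟩ := isTorsion_and_exists_iota_eq_branch_of_wuthrichComponent W p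
    (Wuthrich2014.charIdeal_dvd_padicLFunctionBranch_component_of_half hWu) hj hp2 V
    ⟨C, hC⟩ (Or.inl hV) hX.classX3.1 hκ hγ hγ' Dm.isNewformOf D ϖ hϖ
  obtain ⟨h0, h1⟩ := hcert V C hC hord Dm.f Dm.isNewformOf ϖ hϖ
  exact ⟨hXt, mu_eq_zero_and_lam_le_one_of_iota_eq D hchar hg hι h0 h1⟩

/-- Hence n1011-p01's typed λ-input `CharLamLeAt W p 1` HOLDS on X4♯(G-ord) ∩ `I₀*` ∩ {`ρ̄` onto},
`p ≥ 5`, given the certificate. [cite: Kato2004Asterisque, Thm. 17.4 (3) (p. 273)] -/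
theorem ClassX4Gord.charLamLeAt_one_of_katoHalf_of_cert
    (hK : Wuthrich2014.kato_halfEigenCharIdeal_dvd_cyclotomicPrime_of_surjective)
    (hmodD : nonempty_modularParametrizationData)
    (hX : ClassX4Gord W p) (hp5 : 5 ≤ p) (he : semistabilityIndex W p = 2) (hsurj : Surj W p)
    (hcert : BranchUnitCertificateAt W p) : CharLamLeAt W p 1 :=
  fun _ _ hκ hγ hγ' D _ hchar ↦
    (hX.isTorsion_and_mu_zero_lam_le_one_of_katoHalf_of_cert hK hmodD hp5 he hsurj hcert hκ hγ hγ' D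
      hchar).2.2

/-- Hence `CharLamLeAt W p 1` HOLDS on X3♯(G-ord) ∩ `I₀*`, odd `p`, given the certificate.
[cite: Wuthrich2014, Thm. 16 (p. 397)] -/
theorem ClassX3Gord.charLamLeAt_one_of_wuthrichHalf_of_cert
    (hWu : Wuthrich2014.thm16_halfEigenCharIdeal_dvd_cyclotomicPrime)
    (hmodD : nonempty_modularParametrizationData)
    (hp2 : p ≠ 2) (hX : ClassX3Gord W p) (he : semistabilityIndex W p = 2)
    (hcert : BranchUnitCertificateAt W p) : CharLamLeAt W p 1 :=
  fun _ _ hκ hγ hγ' D _ hchar ↦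
    (hX.isTorsion_and_mu_zero_lam_le_one_of_wuthrichHalf_of_cert hWu hmodD hp2 he hcert hκ hγ hγ' D
      hchar).2.2

end Summit.BirchSwinnertonDyer.Rank1Residual.Additive

end
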